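import Literature.Analysis.FunctionSpaces.TorusPoincareMorrey
import Literature.Analysis.FunctionSpaces.TorusRieszTransformProofs
import Literature.Analysis.FunctionSpaces.TorusInverseLaplacianCalculus
import HarnessLib

/-!
# `L^p` and sup-norm control of lower-order derivatives by the Laplacian on the flat torus

Analysis/FunctionSpaces support file (everything proved; no definitions, no named facts). It
combines the tree's Calderón–Zygmund bound `‖∂ⱼ∂ₖw‖_{L^p(T^d)} ≤ C_p‖Δw‖_{L^p(T^d)}`,
`1 < p < ∞` (`Torus.eLpNorm_hessian_le_laplacian_holds`, `TorusRieszTransformProofs`;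
Robinson–Rodrigo–Sadowski 2016, Thm. B.7) with the Poincaré–Wirtinger and Morrey inequalities of
`TorusPoincareMorrey` into the three a-priori estimates for smooth real functions on `T^d` that
make up the printed proof of Cheskidov–Luo 2022, Thm. 7.3 (the `L^p` bound, `1 ≤ p ≤ ∞`, of the
antidivergence `ℛ`, built from `∂ᵢΔ⁻¹` and `∂ᵢ∂ⱼ∂ₖΔ⁻²`; discharged in
`FluidPDE/TorusLpOperatorFactsAntidivergenceProofs`):

* `Torus.exists_eLpNorm_partialDeriv_le_laplacian` — `1 < p < ∞`: **`‖∂ᵢu‖_p ≤ K ‖Δu‖_p`**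
  ("boundedness of the Riesz transforms and the Poincaré inequality": `∂ᵢu` has zero mean, so
  `‖∂ᵢu‖_p ≤ d Σⱼ ‖∂ⱼ∂ᵢu‖_p ≤ d² C_p ‖Δu‖_p`);
* `Torus.exists_enorm_partialDeriv_le_laplacian` — **`sup |∂ᵢu| ≤ K ‖Δu‖_q`**, `q = d + 2`
  ("the Sobolev embedding `W^{1,d+1}(𝕋^d) ↪ L^∞` … and the boundedness of the Riesz transforms
  once again": Morrey for the zero-mean `∂ᵢu`, then Calderón–Zygmund at the exponent `q`; any
  `q > d` would do, `d + 2 > 1` also when `d` is empty);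
* `Torus.exists_enorm_partialDeriv_partialDeriv_le` — **`sup |∂ᵢ∂ⱼφ| ≤ K Σₘ ‖∂ₘΔφ‖_q`**, `q = d + 2`
  (Morrey for the zero-mean `∂ᵢ∂ⱼφ`, Schwarz `∂ₘ∂ᵢ∂ⱼφ = ∂ᵢ∂ⱼ∂ₘφ`, Calderón–Zygmund for `∂ₘφ`, and
  `Δ∂ₘφ = ∂ₘΔφ`): the sup-norm input for the third-order operator `∂ᵢ∂ⱼΔ⁻¹(∂ₖΔ⁻¹·)`.

Constants are existential (`ℝ≥0`), depending on `d` and the exponent only.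

## References

* A. Cheskidov, X. Luo, *Sharp nonuniqueness for the Navier–Stokes equations*, Invent. Math. 229
  (2022) = arXiv:2009.06596, §7.2, proof of Thm. 7.3. [`CheskidovLuo2022`]
* J. C. Robinson, J. L. Rodrigo, W. Sadowski, *The Three-Dimensional Navier–Stokes Equations*
  (CUP 2016), App. B Thm. B.7 (the Calderón–Zygmund input). [`RobinsonRodrigoSadowskiCUP2016`]
* L. C. Evans, *Partial Differential Equations*, 2nd ed. (2010), §5.6.2 Thm. 4, §5.8.1 Thm. 1.
-/

noncomputable section

open MeasureTheory Set Filter Function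
open scoped ENNReal NNReal ContDiff

namespace Literature.Analysis.FunctionSpaces

namespace Torus

variable {d : Type*} [Fintype d] [DecidableEq d]

/-! ## `1 < p < ∞`: Riesz transforms and Poincaré -/

/-- **`‖∂ᵢu‖_{L^p(T^d)} ≤ K ‖Δu‖_{L^p(T^d)}` for `1 < p < ∞`** and all smooth real `u` on `T^d`
(Cheskidov–Luo 2022, proof of Thm. 7.3, case `1 < p < ∞`: "boundedness of the Riesz transforms and
the Poincaré inequality" — `∂ᵢu` has zero mean, `Torus.eLpNorm_le_of_hasZeroMean`, and
`‖∂ⱼ∂ᵢu‖_p ≤ C_p ‖Δu‖_p`, `Torus.eLpNorm_hessian_le_laplacian_holds`).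
[cite: CheskidovLuo2022, §7.2 proof of Thm. 7.3] -/
theorem exists_eLpNorm_partialDeriv_le_laplacian {p : ℝ≥0∞} (hp1 : 1 < p) (hp : p < ⊤) :
    ∃ K : ℝ≥0, ∀ u : UnitAddTorus d → ℝ, IsSmooth u → ∀ i : d,
      eLpNorm (partialDeriv i u) p volume ≤ K * eLpNorm (laplacian u) p volume := by
  obtain ⟨C, hC⟩ := eLpNorm_hessian_le_laplacian_holds (d := d) p hp1 hp
  refine ⟨Fintype.card d * (Fintype.card d * C), fun u hu i => ?_⟩
  have hw : IsSmooth (partialDeriv i u) := hu.partialDeriv i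
  have h0 : HasZeroMean (partialDeriv i u) := integral_partialDeriv_eq_zero_holds hu i
  have h1 := eLpNorm_le_of_hasZeroMean (hw.isContDiff (by simp)) h0 hp1.le hp.ne
  have h2 := eLpNorm_norm_fderiv_le_sum (hw.isContDiff (by simp)) hp1.le
  calc eLpNorm (partialDeriv i u) p volume
      ≤ (Fintype.card d : ℝ≥0∞) * eLpNorm (fun x => ‖Torus.fderiv (partialDeriv i u) x‖) p volume := h1
    _ ≤ (Fintype.card d : ℝ≥0∞) * ∑ j, eLpNorm (partialDeriv j (partialDeriv i u)) p volume :=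
        mul_le_mul' le_rfl h2
    _ ≤ (Fintype.card d : ℝ≥0∞) * ∑ _j : d, (C : ℝ≥0∞) * eLpNorm (laplacian u) p volume :=
        mul_le_mul' le_rfl (Finset.sum_le_sum fun j _ => hC u hu j i)
    _ = ((Fintype.card d * (Fintype.card d * C) : ℝ≥0) : ℝ≥0∞) * eLpNorm (laplacian u) p volume := by
        rw [Finset.sum_const, Finset.card_univ, nsmul_eq_mul]
        push_cast
        ring

/-! ## The sup norm: Morrey and Riesz transforms at the exponent `q = d + 2` -/

omit [DecidableEq d] in
variable (d) in
/-- The auxiliary exponent `q = d + 2` (`> d` for Morrey, `> 1` for Calderón–Zygmund). [folklore] -/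
theorem one_lt_card_add_two : (1 : ℝ≥0∞) < ENNReal.ofReal ((Fintype.card d : ℝ) + 2) := by
  rw [← ENNReal.ofReal_one]
  exact (ENNReal.ofReal_lt_ofReal_iff (by positivity)).2
    (by linarith [(Nat.cast_nonneg (Fintype.card d) : (0 : ℝ) ≤ _)])

/-- **`sup |∂ᵢu| ≤ K ‖Δu‖_{L^q(T^d)}`, `q = d + 2`**, for all smooth real `u` on `T^d`, pointwise in
the extended norm (Cheskidov–Luo 2022, proof of Thm. 7.3, case `p = ∞`: "the Sobolev embedding
`W^{1,d+1}(𝕋^d) ↪ L^∞(𝕋^d)` … where we have used the boundedness of the Riesz transforms once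
again" — here Morrey's inequality `Torus.enorm_le_of_hasZeroMean` for the zero-mean `∂ᵢu` and
`Torus.eLpNorm_hessian_le_laplacian_holds` at the exponent `q`).
[cite: CheskidovLuo2022, §7.2 proof of Thm. 7.3] -/
theorem exists_enorm_partialDeriv_le_laplacian :
    ∃ K : ℝ≥0, ∀ u : UnitAddTorus d → ℝ, IsSmooth u → ∀ (i : d) (x : UnitAddTorus d),
      ‖partialDeriv i u x‖ₑ ≤
        K * eLpNorm (laplacian u) (ENNReal.ofReal ((Fintype.card d : ℝ) + 2)) volume := by
  set q : ℝ := (Fintype.card d : ℝ) + 2 with hq_def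
  have hq1 : 1 ≤ q := by rw [hq_def]; linarith [(Nat.cast_nonneg (Fintype.card d) : (0 : ℝ) ≤ _)]
  have hq : (Fintype.card d : ℝ) < q := by rw [hq_def]; linarith
  have hq1' : (1 : ℝ≥0∞) < ENNReal.ofReal q := one_lt_card_add_two d
  obtain ⟨C, hC⟩ := eLpNorm_hessian_le_laplacian_holds (d := d) (ENNReal.ofReal q) hq1' ENNReal.ofReal_lt_top
  refine ⟨Fintype.card d * Real.toNNReal (q / (q - Fintype.card d)) * (Fintype.card d * C), fun u hu i x => ?_⟩
  have hw : IsSmooth (partialDeriv i u) := hu.partialDeriv i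
  have h0 : HasZeroMean (partialDeriv i u) := integral_partialDeriv_eq_zero_holds hu i
  have h1 := enorm_le_of_hasZeroMean (hw.isContDiff (by simp)) h0 hq1 hq x
  have h2 := eLpNorm_norm_fderiv_le_sum (hw.isContDiff (by simp)) hq1'.le
  calc ‖partialDeriv i u x‖ₑ
      ≤ (Fintype.card d : ℝ≥0∞) * ENNReal.ofReal (q / (q - Fintype.card d)) *
          eLpNorm (fun z => ‖Torus.fderiv (partialDeriv i u) z‖) (ENNReal.ofReal q) volume := h1
    _ ≤ (Fintype.card d : ℝ≥0∞) * ENNReal.ofReal (q / (q - Fintype.card d)) *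
          ∑ j, eLpNorm (partialDeriv j (partialDeriv i u)) (ENNReal.ofReal q) volume :=
        mul_le_mul' le_rfl h2
    _ ≤ (Fintype.card d : ℝ≥0∞) * ENNReal.ofReal (q / (q - Fintype.card d)) *
          ∑ _j : d, (C : ℝ≥0∞) * eLpNorm (laplacian u) (ENNReal.ofReal q) volume :=
        mul_le_mul' le_rfl (Finset.sum_le_sum fun j _ => hC u hu j i)
    _ = ((Fintype.card d * Real.toNNReal (q / (q - Fintype.card d)) * (Fintype.card d * C) : ℝ≥0) : ℝ≥0∞) *
          eLpNorm (laplacian u) (ENNReal.ofReal q) volume := by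
        rw [Finset.sum_const, Finset.card_univ, nsmul_eq_mul, ENNReal.ofReal]
        push_cast
        ring

/-- **`sup |∂ᵢ∂ⱼφ| ≤ K Σₘ ‖∂ₘΔφ‖_{L^q(T^d)}`, `q = d + 2`**, for all smooth real `φ` on `T^d`,
pointwise in the extended norm: Morrey's inequality for the zero-mean `∂ᵢ∂ⱼφ`, Schwarz
(`∂ₘ∂ᵢ∂ⱼφ = ∂ᵢ∂ⱼ∂ₘφ`), the Calderón–Zygmund bound for `∂ₘφ` at the exponent `q`, and
`Δ∂ₘφ = ∂ₘΔφ`. With `φ = Δ⁻¹g` this is the `L^∞` bound of the order-zero-plus-one composite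
`∂ᵢ∂ⱼΔ⁻¹` against `∇g` used for `Δ⁻²∂ᵢ∂ⱼ∂ₖ` in Cheskidov–Luo 2022, proof of Thm. 7.3, `p = ∞`.
[cite: CheskidovLuo2022, §7.2 proof of Thm. 7.3] -/
theorem exists_enorm_partialDeriv_partialDeriv_le :
    ∃ K : ℝ≥0, ∀ φ : UnitAddTorus d → ℝ, IsSmooth φ → ∀ (i j : d) (x : UnitAddTorus d),
      ‖partialDeriv i (partialDeriv j φ) x‖ₑ ≤
        K * ∑ m, eLpNorm (partialDeriv m (laplacian φ)) (ENNReal.ofReal ((Fintype.card d : ℝ) + 2)) volume := by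
  set q : ℝ := (Fintype.card d : ℝ) + 2 with hq_def
  have hq1 : 1 ≤ q := by rw [hq_def]; linarith [(Nat.cast_nonneg (Fintype.card d) : (0 : ℝ) ≤ _)]
  have hq : (Fintype.card d : ℝ) < q := by rw [hq_def]; linarith
  have hq1' : (1 : ℝ≥0∞) < ENNReal.ofReal q := one_lt_card_add_two d
  obtain ⟨C, hC⟩ := eLpNorm_hessian_le_laplacian_holds (d := d) (ENNReal.ofReal q) hq1' ENNReal.ofReal_lt_top
  refine ⟨Fintype.card d * Real.toNNReal (q / (q - Fintype.card d)) * C, fun φ hφ i j x => ?_⟩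
  have hψ : IsSmooth (partialDeriv i (partialDeriv j φ)) := (hφ.partialDeriv j).partialDeriv i
  have h0 : HasZeroMean (partialDeriv i (partialDeriv j φ)) :=
    integral_partialDeriv_eq_zero_holds (hφ.partialDeriv j) i
  have h1 := enorm_le_of_hasZeroMean (hψ.isContDiff (by simp)) h0 hq1 hq x
  have h2 := eLpNorm_norm_fderiv_le_sum (hψ.isContDiff (by simp)) hq1'.le
  -- Schwarz: `∂ₘ∂ᵢ∂ⱼφ = ∂ᵢ∂ⱼ∂ₘφ`, then Calderón–Zygmund and `Δ∂ₘφ = ∂ₘΔφ`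
  have h3 : ∀ m, eLpNorm (partialDeriv m (partialDeriv i (partialDeriv j φ))) (ENNReal.ofReal q) volume ≤
      C * eLpNorm (partialDeriv m (laplacian φ)) (ENNReal.ofReal q) volume := by
    intro m
    have e1 : partialDeriv m (partialDeriv i (partialDeriv j φ)) =
        partialDeriv i (partialDeriv j (partialDeriv m φ)) := by
      funext y
      rw [partialDeriv_comm (hφ.partialDeriv j) m i y]
      have e2 : partialDeriv m (partialDeriv j φ) = partialDeriv j (partialDeriv m φ) :=
        funext fun z => partialDeriv_comm hφ m j z
      rw [e2]
    have e3 : laplacian (partialDeriv m φ) = partialDeriv m (laplacian φ) :=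
      funext fun y => (partialDeriv_laplacian_comm hφ m y).symm
    rw [e1, ← e3]
    exact hC (partialDeriv m φ) (hφ.partialDeriv m) i j
  calc ‖partialDeriv i (partialDeriv j φ) x‖ₑ
      ≤ (Fintype.card d : ℝ≥0∞) * ENNReal.ofReal (q / (q - Fintype.card d)) *
          eLpNorm (fun z => ‖Torus.fderiv (partialDeriv i (partialDeriv j φ)) z‖) (ENNReal.ofReal q) volume := h1
    _ ≤ (Fintype.card d : ℝ≥0∞) * ENNReal.ofReal (q / (q - Fintype.card d)) *
          ∑ m, eLpNorm (partialDeriv m (partialDeriv i (partialDeriv j φ))) (ENNReal.ofReal q) volume :=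
        mul_le_mul' le_rfl h2
    _ ≤ (Fintype.card d : ℝ≥0∞) * ENNReal.ofReal (q / (q - Fintype.card d)) *
          ∑ m, (C : ℝ≥0∞) * eLpNorm (partialDeriv m (laplacian φ)) (ENNReal.ofReal q) volume :=
        mul_le_mul' le_rfl (Finset.sum_le_sum fun m _ => h3 m)
    _ = ((Fintype.card d * Real.toNNReal (q / (q - Fintype.card d)) * C : ℝ≥0) : ℝ≥0∞) *
          ∑ m, eLpNorm (partialDeriv m (laplacian φ)) (ENNReal.ofReal q) volume := by
        rw [← Finset.mul_sum, ENNReal.ofReal]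
        push_cast
        ring

end Torus

end Literature.Analysis.FunctionSpaces
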